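import Mathlib

/-!
# The transversal dictionary: principal minors of `X_H⁻¹ Y_H` versus transversal minors of `H`

Support file (part 1 of 2) for item `stmt-ValiantsHypothesis-19153`
(`BarrierLever.TransversalSufficesForPrincipal`, the arrow TT → TNS; route
`route-ValiantsHypothesis-BarrierLever`, cell valiant-natproofs, rung V4, 𝒟-side of door (c)).

For a square matrix `H` indexed by `α ⊕ α` (rows and columns come in pairs `inl a, inr a`) the
*transversal minor* of `u, w ⊆ α` is `Θ_H[u,w] = det H[ρ_u, σ_w]` with
`ρ_u a = inl a` if `a ∈ u` else `inr a`, and `σ_w c = inr c` if `c ∈ w` else `inl c`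
(one row from each row pair, one column from each column pair); the *principal* minor attached to
`(u, w)` is `det K[u ⊔ w]`, `u ⊔ w = u.disjSum w`.

## The dictionary (proved here, def-free: the objects are described by hypotheses)

Let `X` be the matrix whose column `inl a` is the unit vector `e_{inl a}` and whose column
`inr c` is the column `inl c` of `H`, and `Y` the matrix with columns `e_{inr a}` resp. the
column `inr c` of `H` (hypotheses `hXl hXr hYl hYr` below).  In block form `X = [[1, A], [0, B]]`
for `H = [[A, C], [B, D]]`, so `det X = det B` (`det_eq_det_lowerLeft`).  If `det B ≠ 0` and
`K := X⁻¹ * Y` (this is the matrix `[[-AB⁻¹, C - AB⁻¹D], [B⁻¹, B⁻¹D]]` of the item's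
docstring), the *mixed-column formula for principal minors* (`det_mul_det_principal`)

  `det X · det K[S,S] = det (Y on the columns in S | X on the other columns)`   (`X * K = Y`)

applies; for `S = u ⊔ w` the right-hand matrix has unit columns `e_{σ_u a}` at the positions
`inl a` and the columns `σ_w c` of `H` at the positions `inr c`, so after the row involution
`inl a ↦ σ_u a, inr a ↦ ρ_u a` it is block triangular with diagonal blocks `1` and
`H[ρ_u, σ_w]` (`exists_sign_det_mixed`):

  `det B · det K[u ⊔ w] = ε(u) · Θ_H[u,w]`,  `ε(u) = ±1` depending on `u` only
  (`exists_sign_dictionary`).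

Hence for `det B ≠ 0` some `K` has principal-minor layout matrix `diag(c_i) · Θ_H[U,W]` with all
`c_i ≠ 0` (`exists_principal_eq_smul_transversal`), nonsingular as soon as the transversal layout
matrix is (`exists_principal_layout_det_ne_zero`).  Part 2
(`BarrierLeverTransversalSufficesForPrincipal.lean`) adds the genericity step `det B ≠ 0` and the
transport `Fin h ⊕ Fin h ≃ Fin (h + h)` to the item.

## What this is NOT

Not a proof of TT or TNS (items 19152 / 19126 stay open conjectures with census evidence through
`h = 8`); not a statement about crux `SuccinctHittingSetsForVP` (stmt-14610).  Pure linear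
algebra (Plücker-coordinate bookkeeping for `Gr(2h, 4h)` done with block matrices). [folklore]
-/

-- layout Summits/ValiantsHypothesis/ValiantsHypothesis forces the duplicated namespace component
set_option linter.dupNamespace false

namespace Summit.ValiantsHypothesis.ValiantsHypothesis.Theorems.BarrierLever.TransversalDictionary

open Matrix

/-! ## Principal minors as mixed-column determinants (any commutative ring) -/

section general

variable {R : Type*} [CommRing R] {n : Type*} [Fintype n] [DecidableEq n]

/-- left multiplication acts column by column on a mixed-column matrix. -/
theorem mul_cols_ite (X A B : Matrix n n R) (S : Finset n) :
    X * (Matrix.of fun i j => if j ∈ S then A i j else B i j) =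
      Matrix.of fun i j => if j ∈ S then (X * A) i j else (X * B) i j := by
  ext i j
  by_cases hj : j ∈ S
  · simp only [Matrix.mul_apply, Matrix.of_apply, hj, if_true]
  · simp only [Matrix.mul_apply, Matrix.of_apply, hj, if_false]

/-- The principal minor of `K` on `S` is the determinant of the matrix that agrees with `K` on
the columns in `S` and with the identity matrix on the other columns. -/
theorem det_cols_one (K : Matrix n n R) (S : Finset n) :
    (Matrix.of fun i j => if j ∈ S then K i j else (1 : Matrix n n R) i j).det =
      (K.submatrix (Subtype.val : ↥S → n) (Subtype.val : ↥S → n)).det := by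
  let e : {a // a ∈ S} ⊕ {a // a ∉ S} ≃ n := Equiv.sumCompl (fun a => a ∈ S)
  rw [← Matrix.det_submatrix_equiv_self e
    (Matrix.of fun i j => if j ∈ S then K i j else (1 : Matrix n n R) i j)]
  have he : (Matrix.of fun i j => if j ∈ S then K i j else (1 : Matrix n n R) i j).submatrix e e =
      Matrix.fromBlocks (K.submatrix (Subtype.val : ↥S → n) (Subtype.val : ↥S → n)) 0
        (K.submatrix (Subtype.val : {a // a ∉ S} → n) (Subtype.val : ↥S → n)) 1 := by
    ext (i | i) (j | j)
    · simp [e, j.2]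
    · have hij : (i : n) ≠ (j : n) := fun h => j.2 (h ▸ i.2)
      simp [e, j.2, hij]
    · simp [e, j.2]
    · simp [e, j.2, Matrix.one_apply, Subtype.ext_iff]
  rw [he, Matrix.det_fromBlocks_zero₁₂, Matrix.det_one, mul_one]

/-- **Mixed-column formula for principal minors.** If `X * K = Y` then
`det X · det K[S,S] = det (Y on the columns in S | X elsewhere)`. -/
theorem det_mul_det_principal {X K Y : Matrix n n R} (hXK : X * K = Y) (S : Finset n) :
    X.det * (K.submatrix (Subtype.val : ↥S → n) (Subtype.val : ↥S → n)).det =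
      (Matrix.of fun i j => if j ∈ S then Y i j else X i j).det := by
  rw [← det_cols_one, ← Matrix.det_mul, mul_cols_ite, hXK, Matrix.mul_one]

end general

/-! ## Paired indices: the transversal dictionary -/

section pairs

variable {R : Type*} [CommRing R] {α : Type*} [DecidableEq α]

/-- the row involution of `α ⊕ α` attached to `u`: `inl a ↦ σ_u a`, `inr a ↦ ρ_u a`
(swap the two members of the pair `a` exactly when `a ∈ u`). -/
theorem swap_involutive (u : Finset α) :
    Function.Involutive (Sum.elim (fun a : α => if a ∈ u then Sum.inr a else Sum.inl a)
      (fun a : α => if a ∈ u then (Sum.inl a : α ⊕ α) else Sum.inr a)) := by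
  rintro (a | a)
  · by_cases ha : a ∈ u <;> simp [ha]
  · by_cases ha : a ∈ u <;> simp [ha]

/-- `σ_u` is injective. -/
theorem cpick_eq_cpick_iff (u : Finset α) (a b : α) :
    ((if a ∈ u then Sum.inr a else Sum.inl a : α ⊕ α) =
        if b ∈ u then Sum.inr b else Sum.inl b) ↔ a = b := by
  constructor
  · intro h
    by_cases ha : a ∈ u <;> by_cases hb : b ∈ u <;> simp [ha, hb] at h <;> exact h
  · rintro rfl
    rfl

/-- `ρ_u a` and `σ_u b` never coincide. -/
theorem pick_ne_cpick (u : Finset α) (a b : α) :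
    (if a ∈ u then Sum.inl a else Sum.inr a : α ⊕ α) ≠
      if b ∈ u then Sum.inr b else Sum.inl b := by
  by_cases ha : a ∈ u <;> by_cases hb : b ∈ u <;> simp [ha, hb]
  · rintro rfl; exact hb ha
  · rintro rfl; exact ha hb

variable [Fintype α]

/-- `det X = det B` for the matrix `X = [[1, A], [0, B]]` (unit columns `e_{inl a}` at `inl a`,
the columns `inl c` of `H` at `inr c`), `B` the lower-left block of `H`. -/
theorem det_eq_det_lowerLeft {H X : Matrix (α ⊕ α) (α ⊕ α) R}
    (hXl : ∀ p a, X p (Sum.inl a) = (1 : Matrix (α ⊕ α) (α ⊕ α) R) p (Sum.inl a))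
    (hXr : ∀ p c, X p (Sum.inr c) = H p (Sum.inl c)) :
    X.det = (H.submatrix Sum.inr Sum.inl).det := by
  have hX : X = Matrix.fromBlocks 1 (H.submatrix Sum.inl Sum.inl) 0
      (H.submatrix Sum.inr Sum.inl) := by
    ext (p | p) (q | q)
    · rw [hXl]; simp [Matrix.one_apply]
    · rw [hXr]; simp
    · rw [hXl]; simp
    · rw [hXr]; simp
  rw [hX, Matrix.det_fromBlocks_zero₂₁, Matrix.det_one, one_mul]

/-- **Block form of the mixed-column matrix.** For `S = u ⊔ w` the matrix
`(Y on the columns in S | X elsewhere)` has unit columns `e_{σ_u a}` at `inl a` and the columns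
`σ_w c` of `H` at `inr c`; after the row involution of `u` it is block upper triangular with
diagonal blocks `1` and the transversal minor `H[ρ_u, σ_w]`, so its determinant is
`ε(u) · Θ_H[u,w]` with a sign `ε(u)` (`ε(u)² = 1`) depending on `u` only. -/
theorem exists_sign_det_mixed (u : Finset α) : ∃ ε : R, ε * ε = 1 ∧
    ∀ (w : Finset α) (H X Y : Matrix (α ⊕ α) (α ⊕ α) R),
      (∀ p a, X p (Sum.inl a) = (1 : Matrix (α ⊕ α) (α ⊕ α) R) p (Sum.inl a)) →
      (∀ p c, X p (Sum.inr c) = H p (Sum.inl c)) →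
      (∀ p a, Y p (Sum.inl a) = (1 : Matrix (α ⊕ α) (α ⊕ α) R) p (Sum.inr a)) →
      (∀ p c, Y p (Sum.inr c) = H p (Sum.inr c)) →
      (Matrix.of fun p q => if q ∈ u.disjSum w then Y p q else X p q).det =
        ε * (H.submatrix (fun a : α => if a ∈ u then Sum.inl a else Sum.inr a)
          (fun c : α => if c ∈ w then Sum.inr c else Sum.inl c)).det := by
  let π : Equiv.Perm (α ⊕ α) := (swap_involutive u).toPerm _
  refine ⟨((Equiv.Perm.sign π : ℤˣ) : ℤ), ?_, ?_⟩
  · rw [← Int.cast_mul, ← Units.val_mul, Int.units_mul_self, Units.val_one, Int.cast_one]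
  intro w H X Y hXl hXr hYl hYr
  set Z : Matrix (α ⊕ α) (α ⊕ α) R :=
    Matrix.of fun p q => if q ∈ u.disjSum w then Y p q else X p q with hZ
  -- the columns of `Z`
  have hZl : ∀ p a, Z p (Sum.inl a) =
      (1 : Matrix (α ⊕ α) (α ⊕ α) R) p (if a ∈ u then Sum.inr a else Sum.inl a) := by
    intro p a
    by_cases ha : a ∈ u
    · rw [hZ, Matrix.of_apply, if_pos (Finset.inl_mem_disjSum.mpr ha), hYl, if_pos ha]
    · rw [hZ, Matrix.of_apply, if_neg (fun h => ha (Finset.inl_mem_disjSum.mp h)), hXl,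
        if_neg ha]
  have hZr : ∀ p c, Z p (Sum.inr c) = H p (if c ∈ w then Sum.inr c else Sum.inl c) := by
    intro p c
    by_cases hc : c ∈ w
    · rw [hZ, Matrix.of_apply, if_pos (Finset.inr_mem_disjSum.mpr hc), hYr, if_pos hc]
    · rw [hZ, Matrix.of_apply, if_neg (fun h => hc (Finset.inr_mem_disjSum.mp h)), hXr,
        if_neg hc]
  -- block form after the row involution
  have hblock : Z.submatrix π id = Matrix.fromBlocks 1
      (H.submatrix (fun a : α => if a ∈ u then Sum.inr a else Sum.inl a)
        (fun c : α => if c ∈ w then Sum.inr c else Sum.inl c)) 0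
      (H.submatrix (fun a : α => if a ∈ u then Sum.inl a else Sum.inr a)
        (fun c : α => if c ∈ w then Sum.inr c else Sum.inl c)) := by
    ext (p | p) (q | q)
    · rw [Matrix.submatrix_apply, id, Function.Involutive.coe_toPerm, Sum.elim_inl, hZl,
        Matrix.fromBlocks_apply₁₁]
      by_cases hpq : p = q
      · subst hpq
        rw [Matrix.one_apply_eq, Matrix.one_apply_eq]
      · rw [Matrix.one_apply_ne hpq,
          Matrix.one_apply_ne (fun h => hpq ((cpick_eq_cpick_iff u p q).mp h))]
    · rw [Matrix.submatrix_apply, id, Function.Involutive.coe_toPerm, Sum.elim_inl, hZr,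
        Matrix.fromBlocks_apply₁₂, Matrix.submatrix_apply]
    · rw [Matrix.submatrix_apply, id, Function.Involutive.coe_toPerm, Sum.elim_inr, hZl,
        Matrix.fromBlocks_apply₂₁, Matrix.zero_apply, Matrix.one_apply_ne (pick_ne_cpick u p q)]
    · rw [Matrix.submatrix_apply, id, Function.Involutive.coe_toPerm, Sum.elim_inr, hZr,
        Matrix.fromBlocks_apply₂₂, Matrix.submatrix_apply]
  have h1 := Matrix.det_permute π Z
  rw [hblock, Matrix.det_fromBlocks_zero₂₁, Matrix.det_one, one_mul] at h1
  -- h1 : Θ = sign π · det Z; multiply by sign π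
  have h2 : ((Equiv.Perm.sign π : ℤˣ) : ℤ) * ((Equiv.Perm.sign π : ℤˣ) : ℤ) = (1 : R) := by
    rw [← Int.cast_mul, ← Units.val_mul, Int.units_mul_self, Units.val_one, Int.cast_one]
  calc Z.det = ((Equiv.Perm.sign π : ℤˣ) : ℤ) * ((Equiv.Perm.sign π : ℤˣ) : ℤ) * Z.det := by
        rw [h2, one_mul]
    _ = _ := by rw [mul_assoc, ← h1]

/-- **The dictionary.** With `X, Y` as above and `X * K = Y`:
`det B · det K[u ⊔ w] = ε(u) · Θ_H[u,w]` for all `w`, the sign `ε(u)` depending on `u` only. -/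
theorem exists_sign_dictionary (u : Finset α) : ∃ ε : R, ε * ε = 1 ∧
    ∀ (w : Finset α) (H X Y K : Matrix (α ⊕ α) (α ⊕ α) R),
      (∀ p a, X p (Sum.inl a) = (1 : Matrix (α ⊕ α) (α ⊕ α) R) p (Sum.inl a)) →
      (∀ p c, X p (Sum.inr c) = H p (Sum.inl c)) →
      (∀ p a, Y p (Sum.inl a) = (1 : Matrix (α ⊕ α) (α ⊕ α) R) p (Sum.inr a)) →
      (∀ p c, Y p (Sum.inr c) = H p (Sum.inr c)) →
      X * K = Y →
      (H.submatrix Sum.inr Sum.inl).det *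
          (K.submatrix (Subtype.val : ↥(u.disjSum w) → α ⊕ α)
            (Subtype.val : ↥(u.disjSum w) → α ⊕ α)).det =
        ε * (H.submatrix (fun a : α => if a ∈ u then Sum.inl a else Sum.inr a)
          (fun c : α => if c ∈ w then Sum.inr c else Sum.inl c)).det := by
  obtain ⟨ε, hε, hdet⟩ := exists_sign_det_mixed (R := R) u
  refine ⟨ε, hε, fun w H X Y K hXl hXr hYl hYr hK => ?_⟩
  rw [← det_eq_det_lowerLeft hXl hXr, det_mul_det_principal hK, hdet w H X Y hXl hXr hYl hYr]

end pairs

/-! ## Over a field: the principal-minor layout matrix of `K = X⁻¹ Y` -/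

section field

variable {F : Type*} [Field F] {α : Type*} [Fintype α] [DecidableEq α]

/-- **Layout form of the dictionary.** If `det B ≠ 0` then some `K` (namely `X⁻¹ Y`) has all
its principal minors `det K[u ⊔ w]` equal to `c(u) · Θ_H[u,w]` with nonzero constants `c(u)`
(`c(u) = ε(u) / det B`). -/
theorem exists_principal_eq_smul_transversal {H : Matrix (α ⊕ α) (α ⊕ α) F}
    (hB : (H.submatrix Sum.inr Sum.inl).det ≠ 0) :
    ∃ (K : Matrix (α ⊕ α) (α ⊕ α) F) (c : Finset α → F), (∀ u, c u ≠ 0) ∧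
      ∀ u w : Finset α, (K.submatrix (Subtype.val : ↥(u.disjSum w) → α ⊕ α)
          (Subtype.val : ↥(u.disjSum w) → α ⊕ α)).det =
        c u * (H.submatrix (fun a : α => if a ∈ u then Sum.inl a else Sum.inr a)
          (fun c : α => if c ∈ w then Sum.inr c else Sum.inl c)).det := by
  -- the matrices `X = [[1, A], [0, B]]` and `Y = [[0, C], [1, D]]`
  let X : Matrix (α ⊕ α) (α ⊕ α) F := Matrix.of fun p q =>
    Sum.elim (fun a => (1 : Matrix (α ⊕ α) (α ⊕ α) F) p (Sum.inl a)) (fun c => H p (Sum.inl c)) q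
  let Y : Matrix (α ⊕ α) (α ⊕ α) F := Matrix.of fun p q =>
    Sum.elim (fun a => (1 : Matrix (α ⊕ α) (α ⊕ α) F) p (Sum.inr a)) (fun c => H p (Sum.inr c)) q
  have hXl : ∀ p a, X p (Sum.inl a) = (1 : Matrix (α ⊕ α) (α ⊕ α) F) p (Sum.inl a) :=
    fun _ _ => rfl
  have hXr : ∀ p c, X p (Sum.inr c) = H p (Sum.inl c) := fun _ _ => rfl
  have hYl : ∀ p a, Y p (Sum.inl a) = (1 : Matrix (α ⊕ α) (α ⊕ α) F) p (Sum.inr a) :=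
    fun _ _ => rfl
  have hYr : ∀ p c, Y p (Sum.inr c) = H p (Sum.inr c) := fun _ _ => rfl
  have hXdet : IsUnit X.det := by
    rw [det_eq_det_lowerLeft hXl hXr]
    exact isUnit_iff_ne_zero.mpr hB
  have hK : X * (X⁻¹ * Y) = Y := Matrix.mul_nonsing_inv_cancel_left _ _ hXdet
  have hsign := fun u : Finset α => exists_sign_dictionary (R := F) u
  choose ε hε hdict using hsign
  refine ⟨X⁻¹ * Y, fun u => (H.submatrix Sum.inr Sum.inl).det⁻¹ * ε u, fun u => ?_, fun u w => ?_⟩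
  · exact mul_ne_zero (inv_ne_zero hB) (IsUnit.of_mul_eq_one _ (hε u)).ne_zero
  · rw [mul_assoc, ← hdict u w H X Y (X⁻¹ * Y) hXl hXr hYl hYr hK, ← mul_assoc,
      inv_mul_cancel₀ hB, one_mul]

/-- **TT ⇒ TNS on paired indices.** If `det B ≠ 0` and the transversal layout matrix
`(Θ_H[u_i, w_j])_{i,j}` is nonsingular then some `K` has nonsingular principal-minor layout
matrix `(det K[u_i ⊔ w_j])_{i,j}` (it equals `diag(c(u_i)) · Θ_H[U,W]`). -/
theorem exists_principal_layout_det_ne_zero {H : Matrix (α ⊕ α) (α ⊕ α) F}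
    (hB : (H.submatrix Sum.inr Sum.inl).det ≠ 0) {r : ℕ} (u w : Fin r → Finset α)
    (hΘ : (Matrix.of fun i j : Fin r =>
      (H.submatrix (fun a : α => if a ∈ u i then Sum.inl a else Sum.inr a)
        (fun c : α => if c ∈ w j then Sum.inr c else Sum.inl c)).det).det ≠ 0) :
    ∃ K : Matrix (α ⊕ α) (α ⊕ α) F, (Matrix.of fun i j : Fin r =>
      (K.submatrix (Subtype.val : ↥((u i).disjSum (w j)) → α ⊕ α)
        (Subtype.val : ↥((u i).disjSum (w j)) → α ⊕ α)).det).det ≠ 0 := by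
  obtain ⟨K, c, hc, hK⟩ := exists_principal_eq_smul_transversal hB
  refine ⟨K, ?_⟩
  have hmat : (Matrix.of fun i j : Fin r =>
      (K.submatrix (Subtype.val : ↥((u i).disjSum (w j)) → α ⊕ α)
        (Subtype.val : ↥((u i).disjSum (w j)) → α ⊕ α)).det) =
      Matrix.of fun i j : Fin r => c (u i) *
        (H.submatrix (fun a : α => if a ∈ u i then Sum.inl a else Sum.inr a)
          (fun c : α => if c ∈ w j then Sum.inr c else Sum.inl c)).det := by
    ext i j
    exact hK (u i) (w j)
  rw [hmat, Matrix.det_mul_column]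
  exact mul_ne_zero (Finset.prod_ne_zero_iff.mpr fun i _ => hc (u i)) hΘ

end field

end Summit.ValiantsHypothesis.ValiantsHypothesis.Theorems.BarrierLever.TransversalDictionary
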